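import Summits.HodgeConjecture.HodgeConjecture.Theorems.Ring2WeilCoverageCMFieldCompositeSexticCarriers
import HarnessLib

/-!
# Ring 2 — Weil-type family-coverage census, CM-field rows (X-AF): the composite sextic carrier `ℚ(ζ₇)⁺(√−3) ⊂ ℚ(ζ₂₁)`
# in the kernel and its rational rows `[q] = [1] ⟺ q = x² + 3y²`, prime rows `[ℓ] = [1] ⟺ ℓ = 3 ∨ ℓ ≡ 1 (mod 3)`

HONEST FRAMING: research route conditional on HC_CM; not a corollary; Q11.4-sentence-2 already refuted in dim ≥ 3.

Cell `pub-hodge-ring2`, seat `ring2-b03` (gen 59), census `WEIL-FAMILY-COVERAGE.md` «## b03» b03.24 P.S. (cell (xviii′)).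
The fourth sextic census field `E = ℚ(ζ₇)⁺(√−3)` in Deligne's presentation `η = √−3·θ`, `θ = ζ₇ + ζ₇⁻¹`,
`σ = η² = −3θ²`: carrier `R₂₁ = S³ + 15S² + 54S + 27` (the minimal polynomial of `−3θ²`; `R₂₁(S) = −27·R₇(−S/3 − 4)`).
As in part X-AE: irreducible (no root mod `2`), roots real (from part X-V `zeta7_roots_real_neg`) and negative
(positive coefficients), `Fact` for `E` by part X-AD, and `t = −(σ+6)/(σ+3)` has `σt² = −3` (`√−3 = tη ∈ E`). Part X-AC
then gives the rational rows; §1 gives the prime rows for `K = ℚ(√−3)` on any odd-degree carrier (generalising part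
X-AB's `ℚ(ζ₉)` argument: Fermat's `x² + 3y²`, the dyadic form `u² + uv + v²`, `(−3/ℓ) = −1` for `ℓ ≡ 2 (mod 3)`):

* `mk_prime_eq_split_iff_of_neg_three` (generic), `R21_irreducible_int`, `R21_fact_realPolyQ`, `R21_roots_real_neg`,
  `R21_fact_cmPolyQ`, `R21_root_mul_sq_eq_neg_three`, **`R21_mk_eq_split_iff`**, **`R21_mk_prime_eq_split_iff`**.

READING vs the table of b03.23 (3): `ℚ(ζ₇)⁺(√−3)`: `[2]` non-split (`T = {(2),(3)}`), `S6 ⊇ {𝔭₂₉ ×3, 𝔭₄₁}` with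
`2, 29, 41 ≡ 2 (mod 3)` ✓. THEOREMS ONLY: no `def`, no named fact, no `sorry`; `HC_CM` does not occur; nothing about the
Hodge conjecture is asserted.

## References
* [Deligne1982HodgeCycles] P. Deligne (notes by J. S. Milne), LNM 900 (1982), §4 p. 30 (1), Cor. 4.2.
* [Cox2013] D. A. Cox, *Primes of the form x² + ny²*, 2nd ed., §1 (1.1).
* [Washington1997] L. C. Washington, *Introduction to Cyclotomic Fields*, GTM 83, Ch. 2.
-/

noncomputable section

set_option linter.dupNamespace false

open Polynomial

namespace Summit.HodgeConjecture.HodgeConjecture.Ring2.WeilCoverageCM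

open Literature.AlgebraicGeometry.Deligne1982
open Literature.AlgebraicGeometry.HodgeTheory (splitDiscriminantClassCM)
open Literature.NumberTheory.QuadraticFields.Quadratic (legendreSym_neg_three_eq_one_iff
  exists_eq_sq_add_three_mul_sq_iff)

/-! ### §1 `K = ℚ(√−3)`: the class of every prime, on any odd-degree carrier with `σt² = −3` -/

section EisensteinPrimes

variable {R : Polynomial ℤ} [Fact (Irreducible (realPolyQ R))] [Fact (Irreducible (cmPolyQ R))]

/-- **`[ℓ] = [1] ⟺ ℓ = 3 ∨ ℓ ≡ 1 (mod 3)`** for a prime `ℓ`, on any carrier with `[F:ℚ]` odd and `t ∈ F`, `σt² = −3`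
(`E ⊇ ℚ(√−3)`): part X-AC gives `[ℓ] = [1] ⟺ ℓ = x² + 3y²` over `ℚ`; `3 = 0² + 3·1²`, a prime `ℓ ≡ 1 (3)` is `x² + 3y²`
over `ℤ` (Fermat, tree), and for `ℓ ≡ 2 (3)` there is no rational solution (`ℓ = 2`: `x² + 3y² = u² + uv + v²`,
`u = x + y`, `v = −2y`, anisotropic mod 2; odd `ℓ`: `(−3/ℓ) = −1`; part X-Z descent) — the argument of part X-AB for
`ℚ(ζ₉)`, now uniform. [cite: Cox2013, §1 (1.1)] [cite: Deligne1982HodgeCycles, §4 Cor. 4.2] -/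
theorem mk_prime_eq_split_iff_of_neg_three (hodd : Odd R.natDegree) (t : realField R)
    (ht : AdjoinRoot.root (realPolyQ R) * t ^ 2 = AdjoinRoot.of (realPolyQ R) (-3)) {ℓ : ℕ} (hℓ : ℓ.Prime)
    (q : (realField R)ˣ) (hq : (q : realField R) = AdjoinRoot.of (realPolyQ R) (ℓ : ℚ)) :
    (QuotientGroup.mk q : cmNormResidueGroup R) = splitDiscriminantClassCM R 2 ↔ (ℓ = 3 ∨ ℓ % 3 = 1) := by
  rw [mk_eq_splitDiscriminantClassCM_two_iff_of_odd hodd (by norm_num : (0 : ℚ) < 3) t ht q hq]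
  constructor
  · rintro ⟨x, y, hxy⟩
    by_contra hne
    rw [not_or] at hne
    have h3 : ℓ % 3 = 2 := by
      have h30 : ℓ % 3 ≠ 0 := fun h0 => by
        rcases (Nat.dvd_prime hℓ).1 (Nat.dvd_of_mod_eq_zero h0) with h' | h' <;> omega
      omega
    have hw : ¬ ((ℓ : ℤ) ∣ 1) := fun hd =>
      hℓ.one_lt.ne' (by exact_mod_cast Int.eq_one_of_dvd_one (by positivity) hd)
    by_cases hℓ2 : ℓ = 2
    · subst hℓ2
      exact prime_mul_ne_binaryForm Nat.prime_two 1 1 aniso_two_sq_add_mul_add_sq 1 hw (x + y) (-2 * y)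
        (by push_cast; linear_combination hxy)
    · haveI := Fact.mk hℓ
      have hℓ3 : ℓ ≠ 3 := hne.1
      have h0 : ((-3 : ℤ) : ZMod ℓ) ≠ 0 := by
        intro h0
        rw [Int.cast_neg, neg_eq_zero, ZMod.intCast_zmod_eq_zero_iff_dvd] at h0
        exact hℓ3 ((Nat.prime_dvd_prime_iff_eq hℓ (by norm_num)).1 (by exact_mod_cast h0))
      have hns : ¬ IsSquare ((-3 : ℤ) : ZMod ℓ) := by
        rw [← legendreSym.eq_neg_one_iff (p := ℓ)]
        rcases legendreSym.eq_one_or_neg_one ℓ h0 with h1 | h1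
        · rw [legendreSym_neg_three_eq_one_iff hℓ2 hℓ3] at h1
          omega
        · exact h1
      exact prime_mul_ne_binaryForm hℓ 0 3 (aniso_sq_add_mul_sq_of_not_isSquare 3 hns) 1 hw x y
        (by push_cast; linear_combination hxy)
  · intro h3
    have hℓ2 : ℓ ≠ 2 := by omega
    obtain ⟨x, y, hxy⟩ := (exists_eq_sq_add_three_mul_sq_iff hℓ hℓ2).2 h3
    exact ⟨x, y, by exact_mod_cast hxy⟩

end EisensteinPrimes

/-! ### §2 The carrier `R₂₁ = S³ + 15S² + 54S + 27` of `ℚ(ζ₇)⁺(√−3)` -/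

/-- `S³ + 15S² + 54S + 27` is irreducible over `ℤ`: monic with no root mod `2` (`S³ + S² + 1`). [folklore] -/
theorem R21_irreducible_int : Irreducible (X ^ 3 + C (15 : ℤ) * X ^ 2 + C 54 * X + C 27 : Polynomial ℤ) := by
  have hmonic : (X ^ 3 + C (15 : ℤ) * X ^ 2 + C 54 * X + C 27 : Polynomial ℤ).Monic := by monicity!
  refine hmonic.irreducible_of_irreducible_map (Int.castRingHom (ZMod 2)) _ ?_
  have hmap : Polynomial.map (Int.castRingHom (ZMod 2)) (X ^ 3 + C (15 : ℤ) * X ^ 2 + C 54 * X + C 27) =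
      X ^ 3 + X ^ 2 + 1 := by
    simp only [Polynomial.map_add, Polynomial.map_mul, Polynomial.map_pow, map_X, map_C]
    have h15 : (Int.castRingHom (ZMod 2)) 15 = 1 := by decide
    have h54 : (Int.castRingHom (ZMod 2)) 54 = 0 := by decide
    have h27 : (Int.castRingHom (ZMod 2)) 27 = 1 := by decide
    rw [h15, h54, h27, C_1, C_0, one_mul, zero_mul, add_zero]
  rw [hmap]
  have hm2 : (X ^ 3 + X ^ 2 + 1 : Polynomial (ZMod 2)).Monic := by monicity!
  have hd2 : (X ^ 3 + X ^ 2 + 1 : Polynomial (ZMod 2)).natDegree = 3 := by compute_degree!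
  rw [hm2.irreducible_iff_roots_eq_zero_of_degree_le_three (by rw [hd2]; norm_num) (by rw [hd2])]
  refine Multiset.eq_zero_of_forall_notMem fun a ha => ?_
  rw [mem_roots hm2.ne_zero, IsRoot.def, eval_add, eval_add, eval_pow, eval_pow, eval_X, eval_one] at ha
  fin_cases a <;> revert ha <;> decide

/-- The `Fact` for `F = ℚ[S]/(S³ + 15S² + 54S + 27) = ℚ(ζ₇)⁺` (Gauss). [folklore] -/
theorem R21_fact_realPolyQ :
    Fact (Irreducible (realPolyQ (X ^ 3 + C 15 * X ^ 2 + C 54 * X + C 27 : Polynomial ℤ))) := by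
  refine ⟨?_⟩
  have hmonic : (X ^ 3 + C (15 : ℤ) * X ^ 2 + C 54 * X + C 27 : Polynomial ℤ).Monic := by monicity!
  have h := (hmonic.irreducible_iff_irreducible_map_fraction_map (K := ℚ)).1 R21_irreducible_int
  rwa [algebraMap_int_eq] at h

/-- **The roots of `S³ + 15S² + 54S + 27` are real and negative**: a root `s` gives the root `−s/3 − 4` of
`S³ + 7S² + 14S + 7` (`R₂₁(S) = −27·R₇(−S/3 − 4)`), real by part X-V; positive coefficients force `s < 0`.
[cite: Washington1997, Ch. 2] -/
theorem R21_roots_real_neg :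
    ∀ s : ℂ, Polynomial.eval₂ (Int.castRingHom ℂ) s (X ^ 3 + C 15 * X ^ 2 + C 54 * X + C 27 : Polynomial ℤ) = 0 →
      s.im = 0 ∧ s.re < 0 := by
  haveI := zeta7_fact_cmPolyQ
  intro s hs
  simp only [eval₂_add, eval₂_mul, eval₂_pow, eval₂_X, eval₂_ofNat, eq_intCast, Int.cast_ofNat] at hs
  have h7 : Polynomial.eval₂ (Int.castRingHom ℂ) (-s / 3 - 4)
      (X ^ 3 + C 7 * X ^ 2 + C 14 * X + C 7 : Polynomial ℤ) = 0 := by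
    simp only [eval₂_add, eval₂_mul, eval₂_pow, eval₂_X, eval₂_ofNat, eq_intCast, Int.cast_ofNat]
    linear_combination (-1 / 27 : ℂ) * hs
  obtain ⟨him, -⟩ := zeta7_roots_real_neg (R := X ^ 3 + C 7 * X ^ 2 + C 14 * X + C 7) rfl (-s / 3 - 4) h7
  have hsim : s.im = 0 := by
    have : (-s / 3 - 4 : ℂ).im = -s.im / 3 := by simp [Complex.div_ofNat_im]
    rw [this] at him
    linarith
  refine ⟨hsim, ?_⟩
  have hsr : s = (s.re : ℂ) := Complex.ext (by simp) (by simp [hsim])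
  rw [hsr] at hs
  have hC : ((s.re ^ 3 + 15 * s.re ^ 2 + 54 * s.re + 27 : ℝ) : ℂ) = 0 := by
    push_cast
    exact hs
  have hr : s.re ^ 3 + 15 * s.re ^ 2 + 54 * s.re + 27 = 0 := Complex.ofReal_eq_zero.mp hC
  by_contra hge
  have h0 : 0 ≤ s.re := not_lt.mp hge
  nlinarith [mul_nonneg (mul_nonneg h0 h0) h0, mul_nonneg h0 h0]

/-- The `Fact` for `E = ℚ[T]/(T⁶ + 15T⁴ + 54T² + 27) = ℚ(ζ₇)⁺(√−3)` — by part X-AD. [folklore] -/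
theorem R21_fact_cmPolyQ : Fact (Irreducible (cmPolyQ (X ^ 3 + C 15 * X ^ 2 + C 54 * X + C 27 : Polynomial ℤ))) :=
  haveI := R21_fact_realPolyQ
  fact_irreducible_cmPolyQ_of_roots_real_neg (by monicity!) R21_roots_real_neg

section R21

variable {R : Polynomial ℤ} [Fact (Irreducible (realPolyQ R))]

/-- **`√−3 ∈ ℚ(ζ₇)⁺(√−3)` on the carrier: `t = −(σ+6)/(σ+3)` has `σt² = −3`** (`σ(σ+6)² + 3(σ+3)² = R₂₁(σ) = 0`;
`t = 1/θ`). [cite: Deligne1982HodgeCycles, §4 p. 30] -/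
theorem R21_root_mul_sq_eq_neg_three (hR : R = X ^ 3 + C 15 * X ^ 2 + C 54 * X + C 27) :
    AdjoinRoot.root (realPolyQ R) *
        (-(AdjoinRoot.root (realPolyQ R) + 6) / (AdjoinRoot.root (realPolyQ R) + 3)) ^ 2 =
      AdjoinRoot.of (realPolyQ R) (-3) := by
  have hRQ : realPolyQ R = X ^ 3 + C (15 : ℚ) * X ^ 2 + C (54 : ℚ) * X + C (27 : ℚ) := by
    have h := realPolyQ_eq_of_cubic R hR
    push_cast at h
    exact h
  have hσ := root_rel_of_realPolyQ_eq hRQ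
  simp only [map_ofNat] at hσ
  have hne : AdjoinRoot.root (realPolyQ R) + 3 ≠ 0 := by
    intro h0
    have hm3 : AdjoinRoot.root (realPolyQ R) = -3 := by linear_combination h0
    rw [hm3] at hσ
    norm_num at hσ
  rw [map_neg, map_ofNat, div_pow, ← mul_div_assoc, div_eq_iff (pow_ne_zero 2 hne)]
  linear_combination hσ

end R21

/-- **The rational rows of `W12.ℚ(ζ₇)⁺(√−3)`: `[q] = [(−1)²] = [1] ⟺ q = x² + 3y²` for some `x, y ∈ ℚ`** (part X-AC
with `K = ℚ(√−3)`; stated on the literal carrier with its instances from this file). Table of b03.23: `[2]` non-split;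
`[29w]`, `[41w]` non-split. [cite: Deligne1982HodgeCycles, §4 p. 30 (1) and Cor. 4.2] -/
theorem R21_mk_eq_split_iff :
    haveI := R21_fact_realPolyQ
    ∀ {c : ℚ} (q : (realField (X ^ 3 + C 15 * X ^ 2 + C 54 * X + C 27 : Polynomial ℤ))ˣ),
      (q : realField (X ^ 3 + C 15 * X ^ 2 + C 54 * X + C 27 : Polynomial ℤ)) = AdjoinRoot.of _ c →
      ((QuotientGroup.mk q : cmNormResidueGroup (X ^ 3 + C 15 * X ^ 2 + C 54 * X + C 27 : Polynomial ℤ)) =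
          splitDiscriminantClassCM (X ^ 3 + C 15 * X ^ 2 + C 54 * X + C 27 : Polynomial ℤ) 2 ↔
        ∃ x y : ℚ, c = x ^ 2 + 3 * y ^ 2) := by
  haveI := R21_fact_realPolyQ
  haveI := R21_fact_cmPolyQ
  intro c q hq
  have hodd : Odd (X ^ 3 + C 15 * X ^ 2 + C 54 * X + C 27 : Polynomial ℤ).natDegree :=
    ⟨1, by rw [(monic_and_natDegree_of_cubic (X ^ 3 + C 15 * X ^ 2 + C 54 * X + C 27 : Polynomial ℤ) rfl).2]; rfl⟩
  exact mk_eq_splitDiscriminantClassCM_two_iff_of_odd hodd (by norm_num) _ (R21_root_mul_sq_eq_neg_three rfl) q hq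

/-- **The class of every prime in the `ℚ(ζ₇)⁺(√−3)` table: `[ℓ] = [1] ⟺ ℓ = 3 ∨ ℓ ≡ 1 (mod 3)`** (literal carrier).
[cite: Cox2013, §1 (1.1)] [cite: Deligne1982HodgeCycles, §4 Cor. 4.2] -/
theorem R21_mk_prime_eq_split_iff :
    haveI := R21_fact_realPolyQ
    ∀ {ℓ : ℕ}, ℓ.Prime → ∀ (q : (realField (X ^ 3 + C 15 * X ^ 2 + C 54 * X + C 27 : Polynomial ℤ))ˣ),
      (q : realField (X ^ 3 + C 15 * X ^ 2 + C 54 * X + C 27 : Polynomial ℤ)) = AdjoinRoot.of _ (ℓ : ℚ) →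
      ((QuotientGroup.mk q : cmNormResidueGroup (X ^ 3 + C 15 * X ^ 2 + C 54 * X + C 27 : Polynomial ℤ)) =
          splitDiscriminantClassCM (X ^ 3 + C 15 * X ^ 2 + C 54 * X + C 27 : Polynomial ℤ) 2 ↔ (ℓ = 3 ∨ ℓ % 3 = 1)) := by
  haveI := R21_fact_realPolyQ
  haveI := R21_fact_cmPolyQ
  intro ℓ hℓ q hq
  have hodd : Odd (X ^ 3 + C 15 * X ^ 2 + C 54 * X + C 27 : Polynomial ℤ).natDegree :=
    ⟨1, by rw [(monic_and_natDegree_of_cubic (X ^ 3 + C 15 * X ^ 2 + C 54 * X + C 27 : Polynomial ℤ) rfl).2]; rfl⟩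
  exact mk_prime_eq_split_iff_of_neg_three hodd _ (R21_root_mul_sq_eq_neg_three rfl) hℓ q hq


end Summit.HodgeConjecture.HodgeConjecture.Ring2.WeilCoverageCM

end
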